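import Summits.ResolutionOfSingularities.ResolutionOfSingularities.Theorems.WildConesCampaignW46ThreefoldsCharTwoNearPointExists
import Summits.ResolutionOfSingularities.ResolutionOfSingularities.Theorems.WildConesCampaignW46ThreefoldsCharTwoResolution

/-!
# [OURS · L1 W4.6, rung (ii) at p = 2] THE SINGULAR BRANCH: an order-2-cleaned isolated threefold double point
# in characteristic two with Milnor number `μ` has a chain of EXACTLY `μ/2 − 1` infinitely-near double points,
# and its resolution by point blow-ups takes EXACTLY `μ/2` steps along that branch — over EVERY field of
# characteristic 2

Cell res-hironaka (LADDER-RESOLUTION rung L, D-0089), slot W4.6, seat res-L1-s46-pv-4 (gen 2); host route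
`WildCones`, crux `ClassicalRegimes` (stmt-ResolutionOfSingularities-16884). Sequel to `…CharTwoNearPointExists`
(existence of the near double point iff `μ ≥ 4`) and `…CharTwoResolution` (smooth within `μ/2` blow-ups along
every word, p479500) of the same seat: the upper bound `μ/2` is ATTAINED, for EVERY state of the regime (not
only for the calibrating family `z² = u₀u₁ + u₂^(2j+1)` of p470498).

HONEST FRAMING. Everything here is OURS: theorems about route WildCones' own typed point-blow-up dynamics
(`Theorems/WildConesClassicalRegimesDefs.lean`). It REPLACES THE ROLE of the LENGTH of the procedure of
Th. 16.13 (H. Hironaka, ms. 2017-03-23, p.87 L25–L28 «repeatedly but finitely many times») in ONE regime —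
order-2-cleaned isolated double points `z² = a(u₀,u₁,u₂)` in characteristic `2` — by an EXACT count in OUR
invariant: `μ/2` blow-ups along the singular branch, `≤ μ/2` along every branch. NOTHING here is a statement
of the manuscript [Hironaka2017]; no FACT-LIST premise. AI review is weaker than expert review.

* `threefold_exists_singularBranch` — from `c₀` (`MultP ∧ OrdP ∧ Isol`) there is a chart/translation word along
  which the states `m` with `2m + 2 ≤ μ(c₀)` are all order-2-cleaned isolated double points with
  `μ(state m) = μ(c₀) − 2m` (choose at each stage the near double point of `…NearPointExists`, unique by
  `…NearPoint`).
* `threefold_singularBranch_exact` — along that word the state `μ(c₀)/2` is NOT a double point and carries a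
  linear cleaned monomial (smooth): the branch has exactly `μ/2` double points `0, …, μ/2 − 1` and is resolved
  at step `μ/2`; with `threefold_smooth_le_half` (every word is smooth by step `μ/2`) the depth of the
  point-blow-up resolution tree of `c₀` is EXACTLY `μ(c₀)/2`.

References: G.-M. Greuel, G. Pfister, J. Algebra 689 (2026) = arXiv:2507.17078 [GreuelPfister2026] (through
the tree); H. Hironaka, ms. 2017, Th. 16.13 p.87 — quoted for the ROLE replaced only, under adjudication,
not cited as fact.
-/

noncomputable section

-- single-problem summit: the doubled namespace component `ResolutionOfSingularities` is forced
set_option linter.dupNamespace false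

open scoped BigOperators Classical

open MvPowerSeries

open Literature.AlgebraicGeometry.Resolution

namespace Summit.ResolutionOfSingularities.ResolutionOfSingularities.Theorems

namespace CampaignW46.ThreefoldsCharTwo

open WildCones WildCones.MuDropCharTwoOrdP

variable {κ : Type} [Field κ]

/-- [OURS · L1 W4.6 rung (ii) at `p = 2`; NOT a statement of the manuscript] **THE SINGULAR BRANCH EXISTS.**
Over any field of characteristic `2`, from an order-2-cleaned isolated double point `c₀` of
`z² = a(u₀,u₁,u₂)` there are a chart word `i` and a translation word `t` along which every state `m` with
`2m + 2 ≤ μ(c₀)` is an order-2-cleaned isolated double point with `μ(state m) + 2m = μ(c₀)`: at each stage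
with `μ ≥ 4` the (unique) infinitely-near double point exists (`threefold_exists_double_successor_of_four_le_mu`)
and is chosen; the regime is kept by `threefold_regime_step`. [cite: GreuelPfister2026, Thm 3.5 and Cor 3.7] -/
theorem threefold_exists_singularBranch [CharP κ 2] (c₀ : (Fin 3 → ℕ) → κ) (hM₀ : MultP 2 3 κ c₀)
    (hO₀ : OrdP 2 3 κ c₀) (hI₀ : Isol 2 3 κ c₀) :
    ∃ (i : ℕ → Fin 3) (t : ℕ → Fin 3 → κ), ∀ m, 2 * m + 2 ≤ mu 2 3 κ c₀ →
      MultP 2 3 κ (run 2 3 κ c₀ i t m) ∧ OrdP 2 3 κ (run 2 3 κ c₀ i t m) ∧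
        Isol 2 3 κ (run 2 3 κ c₀ i t m) ∧ mu 2 3 κ (run 2 3 κ c₀ i t m) + 2 * m = mu 2 3 κ c₀ := by
  classical
  -- a choice of a double successor whenever one exists
  let nxt : ((Fin 3 → ℕ) → κ) → Fin 3 × (Fin 3 → κ) := fun c =>
    if h : ∃ x : Fin 3 × (Fin 3 → κ), MultP 2 3 κ (step 2 3 κ x.1 x.2 c) then h.choose else (0, fun _ => 0)
  have hnxt : ∀ c, (∃ (i : Fin 3) (τ : Fin 3 → κ), MultP 2 3 κ (step 2 3 κ i τ c)) →
      MultP 2 3 κ (step 2 3 κ (nxt c).1 (nxt c).2 c) := by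
    rintro c ⟨i, τ, h⟩
    have hex : ∃ x : Fin 3 × (Fin 3 → κ), MultP 2 3 κ (step 2 3 κ x.1 x.2 c) := ⟨(i, τ), h⟩
    simp only [nxt, dif_pos hex]
    exact hex.choose_spec
  -- the states along the branch, and the words reading them off
  let s : ℕ → (Fin 3 → ℕ) → κ := fun m => Nat.rec c₀ (fun _ c => step 2 3 κ (nxt c).1 (nxt c).2 c) m
  refine ⟨fun m => (nxt (s m)).1, fun m => (nxt (s m)).2, ?_⟩
  have hrun : ∀ m, run 2 3 κ c₀ (fun m => (nxt (s m)).1) (fun m => (nxt (s m)).2) m = s m := by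
    intro m
    induction m with
    | zero => rfl
    | succ m ih =>
      change step 2 3 κ (nxt (s m)).1 (nxt (s m)).2
          (run 2 3 κ c₀ (fun m => (nxt (s m)).1) (fun m => (nxt (s m)).2) m) =
        step 2 3 κ (nxt (s m)).1 (nxt (s m)).2 (s m)
      rw [ih]
  intro m
  rw [hrun m]
  induction m with
  | zero => intro _; exact ⟨hM₀, hO₀, hI₀, rfl⟩
  | succ m ih =>
    intro hm
    obtain ⟨hM, hO, hI, hμ⟩ := ih (by omega)
    have h4 : 4 ≤ mu 2 3 κ (s m) := by omega
    have hM' := hnxt (s m) (threefold_exists_double_successor_of_four_le_mu (s m) hM hO h4)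
    obtain ⟨hO', hI', hμ'⟩ := threefold_regime_step (s m) (nxt (s m)).1 (nxt (s m)).2 hM hO hI hM'
    refine ⟨hM', hO', hI', ?_⟩
    change mu 2 3 κ (step 2 3 κ (nxt (s m)).1 (nxt (s m)).2 (s m)) + 2 * (m + 1) = mu 2 3 κ c₀
    omega

/-- [OURS · L1 W4.6 rung (ii) at `p = 2`, replaces the ROLE of the LENGTH of the procedure of Th. 16.13 p.87
L25–L28 in this regime; NOT a statement of the manuscript] **THE SINGULAR BRANCH HAS EXACTLY `μ/2` DOUBLE
POINTS AND IS THEN RESOLVED.** Over any field of characteristic `2`, from an order-2-cleaned isolated double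
point `c₀` of `z² = a(u₀,u₁,u₂)` there is a chart/translation word along which the states `0, …, μ(c₀)/2 − 1`
are order-2-cleaned isolated double points with `μ(state m) = μ(c₀) − 2m`, and the state `μ(c₀)/2` is NOT a
double point but carries a LINEAR cleaned monomial (a smooth point of the transform). With
`threefold_smooth_le_half` (every word is smooth by step `μ/2`, p479500): the point-blow-up resolution tree of
`c₀` has depth EXACTLY `μ(c₀)/2`. [cite: GreuelPfister2026, Thm 3.5 and Cor 3.7] -/
theorem threefold_singularBranch_exact [CharP κ 2] (c₀ : (Fin 3 → ℕ) → κ) (hM₀ : MultP 2 3 κ c₀)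
    (hO₀ : OrdP 2 3 κ c₀) (hI₀ : Isol 2 3 κ c₀) :
    ∃ (i : ℕ → Fin 3) (t : ℕ → Fin 3 → κ),
      (∀ m, 2 * m + 2 ≤ mu 2 3 κ c₀ →
        MultP 2 3 κ (run 2 3 κ c₀ i t m) ∧ OrdP 2 3 κ (run 2 3 κ c₀ i t m) ∧
          Isol 2 3 κ (run 2 3 κ c₀ i t m) ∧ mu 2 3 κ (run 2 3 κ c₀ i t m) + 2 * m = mu 2 3 κ c₀) ∧
      ¬ MultP 2 3 κ (run 2 3 κ c₀ i t (mu 2 3 κ c₀ / 2)) ∧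
      ∃ A, clean 2 3 κ (run 2 3 κ c₀ i t (mu 2 3 κ c₀ / 2)) A ≠ 0 ∧
        Finset.sum Finset.univ (fun j => A j) = 1 := by
  obtain ⟨i, t, hbr⟩ := threefold_exists_singularBranch c₀ hM₀ hO₀ hI₀
  obtain ⟨k, hk⟩ := threefold_mu_even hM₀ hO₀ hI₀
  have h2 := threefold_two_le_mu hM₀ hO₀ hI₀
  set M := mu 2 3 κ c₀ / 2 with hMdef
  have hMk : M = k := by omega
  -- the state `M` is not a double point: otherwise the prefix `0, …, M` would give `2M + 2 ≤ μ = 2M`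
  have hnot : ¬ MultP 2 3 κ (run 2 3 κ c₀ i t M) := by
    intro hMM
    have hpre : ∀ m ≤ M, MultP 2 3 κ (run 2 3 κ c₀ i t m) := by
      intro m hm
      rcases Nat.lt_or_ge m M with hlt | hge
      · exact (hbr m (by omega)).1
      · have : m = M := le_antisymm hm hge
        rw [this]; exact hMM
    have := threefold_two_mul_add_two_le_mu c₀ i t hO₀ hI₀ hpre
    omega
  refine ⟨i, t, hbr, hnot, exists_linear_of_not_multP ?_ hnot⟩
  -- and it is non-zero: it is the successor of the double point `M - 1` of the branch
  obtain ⟨M', hM'⟩ : ∃ M', M = M' + 1 := ⟨M - 1, by omega⟩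
  rw [hM']
  obtain ⟨hMp, hOp, -, -⟩ := hbr M' (by omega)
  exact ser_step_ne_zero_of_ordP _ (i M') (t M') hMp hOp

end CampaignW46.ThreefoldsCharTwo

end Summit.ResolutionOfSingularities.ResolutionOfSingularities.Theorems

end
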